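import Summits.KontsevichZagierPeriods.KontsevichZagierPeriods.Theses.HurwitzMicroSectors
import Summits.KontsevichZagierPeriods.KontsevichZagierPeriods.Theorems.HurwitzMicroSectorsNormalFormPrinciplePiBoxTransfer
import Summits.KontsevichZagierPeriods.KontsevichZagierPeriods.Theorems.HurwitzMicroSectorsNormalFormPrincipleVariants2283
import Summits.KontsevichZagierPeriods.KontsevichZagierPeriods.Theorems.HurwitzMicroSectorsNormalFormPrincipleVariants2284
import Summits.KontsevichZagierPeriods.KontsevichZagierPeriods.Theorems.HurwitzMicroSectorsNormalFormPrincipleVariants2285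

/-! TTRL-lite variant V2287 of stmt-KontsevichZagierPeriods-3869

Variant V2287 = `stub_boxRigidity` (the leaf `BoxRigidity` of `NormalFormPrinciple`: two BOX-RATIONAL
representations — domain the open unit box, integrand `p/q` over `ℚ` — with equal values are
KZ-equivalent) under the two-sided move `fix_nat:m=5; bound_nat:m'≤3` (left dimension frozen to `5`,
right dimension `≤ 3`). Verdict of the attempt seat: **open** — this file is the exact-strength
certificate, not a proof of the variant. With
`BoxVanishing K` := "every box-rational representation of dimension `K` and value `0` is a relation":
* the GENERAL move `fix_nat:m=K; bound_nat:m'≤b` of this stub is exactly `BoxVanishing (max K b)`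
  (`boxRigidityFixBound_iff_boxVanishingDim`, from the pair theorem
  `boxRigidityPair_iff_boxVanishingDim` of the sibling certificate `…Variants2283`): specialising
  `m' := b` gives the frozen pair `(K, b)`; conversely `BoxVanishing (max K b)` gives rigidity for all
  `m, m' ≤ max K b` (`boxRigidityPair_iff_boxRigidityLe`), which contains the move;
* `V2287 ⟹ BoxVanishing 5` directly (`boxVanishing_five_of_stub_boxRigidity_var2287`: take `m' = 0 ≤ 3`
  and compare with the zero representation on the `0`-box, box-rational of value `0` and itself a
  relation); `BoxVanishing 5 ⟹ BoxRigidity for all m, m' ≤ 5` (`boxRigidityLe_five_of_boxVanishing_five`,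
  sibling `…Variants2284`: pad both representations to the `5`-box by unit intervals, `pad_le`, and
  subtract on the common box, `sub_same`; the difference has value `0` by soundness);
* hence `V2287 ⟺ BoxVanishing 5 ⟺ BoxRigidity(m, m' ≤ 5)` (`stub_boxRigidity_var2287_iff_boxVanishing_five`,
  `stub_boxRigidity_var2287_iff_le_five`): relaxing `m' ≤ 2` (V2284) to `m' ≤ 3` is idle, and V2287 has
  EXACTLY the strength of its siblings V2283 (`m = 5, m' = 2`), V2284 (`m = 5, m' ≤ 2`) and V2285
  (`m ≤ 5, m' ≤ 2`) (`stub_boxRigidity_var2287_iff_var2283/4/5`), all four being `BoxVanishing 5`;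
  the trivial implication `V2287 ⟹ V2284` (`m' ≤ 2 ≤ 3`) is recorded separately
  (`stub_boxRigidity_var2284_of_var2287`) so that it does not depend on the padding machinery;
* `KontsevichZagierPeriods ⟹ parent leaf ⟹ V2287` (`stub_boxRigidity_var2287_of_statement`,
  `stub_boxRigidity_var2287_of_parent`), so a refutation of V2287 would refute the Summit, and the tree has
  no invariant of `KZ.relations` finer than `eval` (soundness, `relations_le_ker_eval_holds`) with which
  to attempt one.
Why open: `BoxVanishing 5 ⟹ BoxVanishing 2` (`boxVanishing_le_five_of_stub_boxRigidity_var2287`), which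
asserts that every vanishing `∫∫_{(0,1)²} p/q` (`p, q ∈ ℚ[x,y]`, `q ≠ 0` on the open square, absolutely
convergent) is generated by the four moves; for the family `[(0,1)², (1 − c(1+x²y²))/(1+x²y²)]`, value
`G − c` (`G` = Catalan's constant, `c : ℚ`), the side conditions of every move are sentences of the theory
of real closed fields with parameters in `ℚ`, independent of the value, so a chain valid at `c` forces
`G = c` by soundness: a proof must, uniformly in `c`, refute `G = c` (irrationality of `G`, open) or make
`G` rational. Dimension `5` adds `ζ(5)`, `π²ζ(3)`, `Li₅` at rationals. The tree's knowledge stops at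
`m, m' ≤ 1` (`boxRigidity_of_le_one`, Baker, file `…BoxRigidityDimOne`). Residual goal: `BoxVanishing 5`.
Source: M. Kontsevich, D. Zagier, *Periods* (2001), §1.2 Conjecture 1 and rules 1)–3).
Pure proof file, no definitions. -/

-- `Summit.<Summit>.<Problem>` is the tree's mandated summit-side namespace (CONVENTIONS §2); for this
-- single-conjunct summit the two coincide, so the duplicate is deliberate.
set_option linter.dupNamespace false

noncomputable section

namespace Summit.KontsevichZagierPeriods.KontsevichZagierPeriods.Theorems

open MeasureTheory Set
open Literature.NumberTheory.Transcendental Literature.NumberTheory.Transcendental.KZ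
open Summit.KontsevichZagierPeriods.KontsevichZagierPeriods.Theses.HurwitzMicroSectors
open Summit.KontsevichZagierPeriods.HurwitzMicroSectors.NormalFormPrinciple.PiBox

/-! ## The general move `fix_nat:m=K; bound_nat:m'≤b` is `BoxVanishing (max K b)` -/

/-- **`BoxRigidity(m = K, m' ≤ b) ⟺ BoxVanishing (max K b)`**: every programmatic move
`fix_nat:m=K; bound_nat:m'≤b` of `stub_boxRigidity` is exactly BoxVanishing at the larger of the two
dimensions. (⇒) specialise `m' := b` and use the pair theorem `boxRigidityPair_iff_boxVanishingDim`;
(⇐) `BoxVanishing (max K b)` gives rigidity for all `m, m' ≤ max K b` (`boxRigidityPair_iff_boxRigidityLe`).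
[cite: KontsevichZagier2001, §1.2 Conjecture 1] -/
theorem boxRigidityFixBound_iff_boxVanishingDim (K b : ℕ) :
    (∀ (m' : ℕ) (N : IntegralRep K) (N' : IntegralRep m'), m' ≤ b →
      N.domain = {x | ∀ i, x i ∈ Set.Ioo (0:ℝ) 1} → N.IsRational →
      N'.domain = {x | ∀ i, x i ∈ Set.Ioo (0:ℝ) 1} → N'.IsRational →
      N.value = N'.value → Equivalent N N') ↔
    (∀ (M : IntegralRep (max K b)), M.domain = {x | ∀ i, x i ∈ Set.Ioo (0:ℝ) 1} →
      M.IsRational → M.value = 0 → of M ∈ relations) := by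
  constructor
  · intro h
    exact (boxRigidityPair_iff_boxVanishingDim K b).1 fun N N' => h b N N' le_rfl
  · intro hvan m' N N' hm'
    exact (boxRigidityPair_iff_boxRigidityLe K b).1 ((boxRigidityPair_iff_boxVanishingDim K b).2 hvan)
      K m' N N' (le_max_left K b) (hm'.trans (le_max_right K b))

/-- **`BoxRigidity(m ≤ a, m' = K') ⟺ BoxVanishing (max a K')`**: the mirror move
`bound_nat:m≤a; fix_nat:m'=K'`, by the same argument from the other side.
[cite: KontsevichZagier2001, §1.2 Conjecture 1] -/
theorem boxRigidityBoundFix_iff_boxVanishingDim (a K' : ℕ) :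
    (∀ (m : ℕ) (N : IntegralRep m) (N' : IntegralRep K'), m ≤ a →
      N.domain = {x | ∀ i, x i ∈ Set.Ioo (0:ℝ) 1} → N.IsRational →
      N'.domain = {x | ∀ i, x i ∈ Set.Ioo (0:ℝ) 1} → N'.IsRational →
      N.value = N'.value → Equivalent N N') ↔
    (∀ (M : IntegralRep (max a K')), M.domain = {x | ∀ i, x i ∈ Set.Ioo (0:ℝ) 1} →
      M.IsRational → M.value = 0 → of M ∈ relations) := by
  constructor
  · intro h
    exact (boxRigidityPair_iff_boxVanishingDim a K').1 fun N N' => h a N N' le_rfl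
  · intro hvan m N N' hm
    exact (boxRigidityPair_iff_boxRigidityLe a K').1 ((boxRigidityPair_iff_boxVanishingDim a K').2 hvan)
      m K' N N' (hm.trans (le_max_left a K')) (le_max_right a K')

/-! ## V2287 ⇒ `BoxVanishing 5` (direct) -/

/-- **V2287 ⇒ `BoxVanishing 5`**: compare a box-rational `N : IntegralRep 5` of value `0` with the zero
representation on the `0`-box (`m' = 0 ≤ 3`; box-rational, value `0`, itself a relation).
[cite: KontsevichZagier2001, §1.2 Conjecture 1] -/
theorem boxVanishing_five_of_stub_boxRigidity_var2287
    (h : ∀ (m' : ℕ) (N : IntegralRep 5) (N' : IntegralRep m'), m' ≤ 3 → N.domain = {x | ∀ i, x i ∈ Set.Ioo (0:ℝ) 1} → N.IsRational → N'.domain = {x | ∀ i, x i ∈ Set.Ioo (0:ℝ) 1} → N'.IsRational → N.value = N'.value → Equivalent N N')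
    (N : IntegralRep 5) (hNd : N.domain = {x | ∀ i, x i ∈ Set.Ioo (0:ℝ) 1}) (hNr : N.IsRational)
    (hv : N.value = 0) : of N ∈ relations := by
  obtain ⟨Z, hZd, hZi⟩ := exists_zeroRep (isSemialgebraic_box 0)
  have hZ : of Z ∈ relations := of_mem_relations_of_eqOn_zero Z (by simp [hZi, EqOn])
  have hZv : Z.value = 0 := by simp [IntegralRep.value, hZi]
  have hZr : Z.IsRational := ⟨0, 1, fun x _ => by simp, fun x _ => by simp [hZi]⟩
  have h' : of N - of Z ∈ relations := h 0 N Z (Nat.zero_le 3) hNd hNr hZd hZr (by rw [hv, hZv])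
  have := relations.add_mem h' hZ
  rwa [sub_add_cancel] at this

/-! ## The variant V2287 itself: exactly `BoxVanishing 5` -/

/-- **V2287 ⟺ `BoxVanishing 5`** — the exact strength of the variant: Conjecture 1 of
Kontsevich–Zagier for box-rational periods of dimension `≤ 5`. [cite: KontsevichZagier2001, §1.2 Conjecture 1] -/
theorem stub_boxRigidity_var2287_iff_boxVanishing_five :
    (∀ (m' : ℕ) (N : IntegralRep 5) (N' : IntegralRep m'), m' ≤ 3 → N.domain = {x | ∀ i, x i ∈ Set.Ioo (0:ℝ) 1} → N.IsRational → N'.domain = {x | ∀ i, x i ∈ Set.Ioo (0:ℝ) 1} → N'.IsRational → N.value = N'.value → Equivalent N N') ↔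
    (∀ (M : IntegralRep 5), M.domain = {x | ∀ i, x i ∈ Set.Ioo (0:ℝ) 1} → M.IsRational →
      M.value = 0 → of M ∈ relations) :=
  ⟨boxVanishing_five_of_stub_boxRigidity_var2287,
    fun hvan m' N N' hm' =>
      boxRigidityLe_five_of_boxVanishing_five hvan 5 m' N N' le_rfl (hm'.trans (by norm_num))⟩

/-- The same equivalence as the instance `K = 5, b = 3` of the general move theorem
`boxRigidityFixBound_iff_boxVanishingDim` (`max 5 3 = 5`). [cite: KontsevichZagier2001, §1.2 Conjecture 1] -/
theorem stub_boxRigidity_var2287_iff_boxVanishing_five' :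
    (∀ (m' : ℕ) (N : IntegralRep 5) (N' : IntegralRep m'), m' ≤ 3 → N.domain = {x | ∀ i, x i ∈ Set.Ioo (0:ℝ) 1} → N.IsRational → N'.domain = {x | ∀ i, x i ∈ Set.Ioo (0:ℝ) 1} → N'.IsRational → N.value = N'.value → Equivalent N N') ↔
    (∀ (M : IntegralRep (max 5 3)), M.domain = {x | ∀ i, x i ∈ Set.Ioo (0:ℝ) 1} → M.IsRational →
      M.value = 0 → of M ∈ relations) :=
  boxRigidityFixBound_iff_boxVanishingDim 5 3

/-- **V2287 ⟺ `BoxRigidity` for all `m, m' ≤ 5`**: the bound `m' ≤ 3` is idle — V2287 coincides with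
the two-sided variant `bound_nat:m≤5; bound_nat:m'≤5` and with every sibling of maximum dimension `5`.
[cite: KontsevichZagier2001, §1.2 Conjecture 1] -/
theorem stub_boxRigidity_var2287_iff_le_five :
    (∀ (m' : ℕ) (N : IntegralRep 5) (N' : IntegralRep m'), m' ≤ 3 → N.domain = {x | ∀ i, x i ∈ Set.Ioo (0:ℝ) 1} → N.IsRational → N'.domain = {x | ∀ i, x i ∈ Set.Ioo (0:ℝ) 1} → N'.IsRational → N.value = N'.value → Equivalent N N') ↔
    (∀ (m m' : ℕ) (N : IntegralRep m) (N' : IntegralRep m'), m ≤ 5 → m' ≤ 5 →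
      N.domain = {x | ∀ i, x i ∈ Set.Ioo (0:ℝ) 1} → N.IsRational →
      N'.domain = {x | ∀ i, x i ∈ Set.Ioo (0:ℝ) 1} → N'.IsRational →
      N.value = N'.value → Equivalent N N') := by
  rw [stub_boxRigidity_var2287_iff_boxVanishing_five, ← stub_boxRigidity_var2284_iff_boxVanishing_five]
  exact stub_boxRigidity_var2284_iff_le_five

/-- **V2287 ⟹ V2284** (the sibling `fix_nat:m=5; bound_nat:m'≤2`), trivially: `m' ≤ 2 ≤ 3`.
[cite: KontsevichZagier2001, §1.2 Conjecture 1] -/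
theorem stub_boxRigidity_var2284_of_var2287
    (h : ∀ (m' : ℕ) (N : IntegralRep 5) (N' : IntegralRep m'), m' ≤ 3 → N.domain = {x | ∀ i, x i ∈ Set.Ioo (0:ℝ) 1} → N.IsRational → N'.domain = {x | ∀ i, x i ∈ Set.Ioo (0:ℝ) 1} → N'.IsRational → N.value = N'.value → Equivalent N N') :
    ∀ (m' : ℕ) (N : IntegralRep 5) (N' : IntegralRep m'), m' ≤ 2 → N.domain = {x | ∀ i, x i ∈ Set.Ioo (0:ℝ) 1} → N.IsRational → N'.domain = {x | ∀ i, x i ∈ Set.Ioo (0:ℝ) 1} → N'.IsRational → N.value = N'.value → Equivalent N N' :=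
  fun m' N N' hm' => h m' N N' (hm'.trans (by norm_num))

/-- **V2287 ⟺ V2284**: relaxing the bound `m' ≤ 2` to `m' ≤ 3` changes nothing, both being
`BoxVanishing 5`. [cite: KontsevichZagier2001, §1.2 Conjecture 1] -/
theorem stub_boxRigidity_var2287_iff_var2284 :
    (∀ (m' : ℕ) (N : IntegralRep 5) (N' : IntegralRep m'), m' ≤ 3 → N.domain = {x | ∀ i, x i ∈ Set.Ioo (0:ℝ) 1} → N.IsRational → N'.domain = {x | ∀ i, x i ∈ Set.Ioo (0:ℝ) 1} → N'.IsRational → N.value = N'.value → Equivalent N N') ↔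
    (∀ (m' : ℕ) (N : IntegralRep 5) (N' : IntegralRep m'), m' ≤ 2 → N.domain = {x | ∀ i, x i ∈ Set.Ioo (0:ℝ) 1} → N.IsRational → N'.domain = {x | ∀ i, x i ∈ Set.Ioo (0:ℝ) 1} → N'.IsRational → N.value = N'.value → Equivalent N N') := by
  rw [stub_boxRigidity_var2287_iff_boxVanishing_five, stub_boxRigidity_var2284_iff_boxVanishing_five]

/-- **V2287 ⟺ V2283** (the sibling `fix_nat:m=5; fix_nat:m'=2`): a fully frozen pair `(5, 2)` already
controls `BoxVanishing 5`. [cite: KontsevichZagier2001, §1.2 Conjecture 1] -/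
theorem stub_boxRigidity_var2287_iff_var2283 :
    (∀ (m' : ℕ) (N : IntegralRep 5) (N' : IntegralRep m'), m' ≤ 3 → N.domain = {x | ∀ i, x i ∈ Set.Ioo (0:ℝ) 1} → N.IsRational → N'.domain = {x | ∀ i, x i ∈ Set.Ioo (0:ℝ) 1} → N'.IsRational → N.value = N'.value → Equivalent N N') ↔
    (∀ (N : IntegralRep 5) (N' : IntegralRep 2), N.domain = {x | ∀ i, x i ∈ Set.Ioo (0:ℝ) 1} → N.IsRational → N'.domain = {x | ∀ i, x i ∈ Set.Ioo (0:ℝ) 1} → N'.IsRational → N.value = N'.value → Equivalent N N') := by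
  rw [stub_boxRigidity_var2287_iff_boxVanishing_five, stub_boxRigidity_var2283_iff_boxVanishing_five]

/-- **V2287 ⟺ V2285** (the sibling `bound_nat:m≤5; bound_nat:m'≤2`). [cite: KontsevichZagier2001, §1.2 Conjecture 1] -/
theorem stub_boxRigidity_var2287_iff_var2285 :
    (∀ (m' : ℕ) (N : IntegralRep 5) (N' : IntegralRep m'), m' ≤ 3 → N.domain = {x | ∀ i, x i ∈ Set.Ioo (0:ℝ) 1} → N.IsRational → N'.domain = {x | ∀ i, x i ∈ Set.Ioo (0:ℝ) 1} → N'.IsRational → N.value = N'.value → Equivalent N N') ↔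
    (∀ (m m' : ℕ) (N : IntegralRep m) (N' : IntegralRep m'), m' ≤ 2 → m ≤ 5 → N.domain = {x | ∀ i, x i ∈ Set.Ioo (0:ℝ) 1} → N.IsRational → N'.domain = {x | ∀ i, x i ∈ Set.Ioo (0:ℝ) 1} → N'.IsRational → N.value = N'.value → Equivalent N N') := by
  rw [stub_boxRigidity_var2287_iff_boxVanishing_five, stub_boxRigidity_var2285_iff_boxVanishing_five]

/-- **V2287 ⇒ `BoxVanishing` in every dimension `≤ 5`**, in particular the dimension-`2` statement that
every vanishing `ℚ`-combination of absolutely convergent `∫∫_{(0,1)²} p/q` is generated by the moves —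
the first open dimension (the residual goal of this attempt). [cite: KontsevichZagier2001, §1.2 Conjecture 1] -/
theorem boxVanishing_le_five_of_stub_boxRigidity_var2287
    (h : ∀ (m' : ℕ) (N : IntegralRep 5) (N' : IntegralRep m'), m' ≤ 3 → N.domain = {x | ∀ i, x i ∈ Set.Ioo (0:ℝ) 1} → N.IsRational → N'.domain = {x | ∀ i, x i ∈ Set.Ioo (0:ℝ) 1} → N'.IsRational → N.value = N'.value → Equivalent N N')
    {j : ℕ} (hj : j ≤ 5) (N : IntegralRep j) (hNd : N.domain = {x | ∀ i, x i ∈ Set.Ioo (0:ℝ) 1})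
    (hNr : N.IsRational) (hv : N.value = 0) : of N ∈ relations :=
  boxVanishing_le_five_of_boxVanishing_five (boxVanishing_five_of_stub_boxRigidity_var2287 h) hj N
    hNd hNr hv

/-- **The parent leaf ⇒ V2287** (specialisation `m := 5`; the hypothesis `m' ≤ 3` is dropped).
[cite: KontsevichZagier2001, §1.2 Conjecture 1] -/
theorem stub_boxRigidity_var2287_of_parent
    (h : ∀ (m m' : ℕ) (N : IntegralRep m) (N' : IntegralRep m'), N.domain = {x | ∀ i, x i ∈ Set.Ioo (0:ℝ) 1} → N.IsRational → N'.domain = {x | ∀ i, x i ∈ Set.Ioo (0:ℝ) 1} → N'.IsRational → N.value = N'.value → Equivalent N N') :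
    ∀ (m' : ℕ) (N : IntegralRep 5) (N' : IntegralRep m'), m' ≤ 3 → N.domain = {x | ∀ i, x i ∈ Set.Ioo (0:ℝ) 1} → N.IsRational → N'.domain = {x | ∀ i, x i ∈ Set.Ioo (0:ℝ) 1} → N'.IsRational → N.value = N'.value → Equivalent N N' :=
  fun m' N N' _ => h 5 m' N N'

/-- **`KontsevichZagierPeriods ⇒ V2287`**: the variant is a special case of Conjecture 1 for the tree's
calculus (`leaves_of_statement`) — so a refutation of the variant would refute the Summit.
[cite: KontsevichZagier2001, §1.2 Conjecture 1] -/
theorem stub_boxRigidity_var2287_of_statement (h : _root_.KontsevichZagierPeriods) :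
    ∀ (m' : ℕ) (N : IntegralRep 5) (N' : IntegralRep m'), m' ≤ 3 → N.domain = {x | ∀ i, x i ∈ Set.Ioo (0:ℝ) 1} → N.IsRational → N'.domain = {x | ∀ i, x i ∈ Set.Ioo (0:ℝ) 1} → N'.IsRational → N.value = N'.value → Equivalent N N' :=
  stub_boxRigidity_var2287_of_parent (leaves_of_statement h).1

end Summit.KontsevichZagierPeriods.KontsevichZagierPeriods.Theorems

end
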